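import Mathlib
import Summits.Ventures.PercRepro.PuncturedLYMUnif55Table

/-!
# PercRepro — (SP) FOR ANY NUMBER OF PAIRWISE DISJOINT `5`-SETS AT LEVEL `5`: POSITIVITY OF THE DENOMINATORS (1)
(p10, gen 41)

`Qp > 0`, `Pp > 0`, `Yc > 0`, `Pc > 0` for `n ≥ 6`, `5k ≤ n`.  Nothing here asserts (SP).
-/

namespace PercRepro.PuncturedLYM.Split.TypeLift.Unif55

/-- `Qp > 0` for `n ≥ 6`, `k ∈ {0, 1} ∪ [2, ∞)`, `5k ≤ n` (three shifts with nonnegative coefficients). -/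
theorem Qp_pos (n k : ℚ) (hn : 6 ≤ n) (hk2 : k = 0 ∨ k = 1 ∨ 2 ≤ k) (hk : 5 * k ≤ n) : 0 < Qp n k := by
  rcases hk2 with rfl | rfl | hk2
  · obtain ⟨n', hn', rfl⟩ : ∃ n', 0 ≤ n' ∧ n = 6 + n' := ⟨n - 6, by linarith, by ring⟩
    have h : Qp (6 + n') 0 = 5 * n' ^ 3 + 64 * n' ^ 2 + 277 * n' + 422 := by unfold Qp; ring
    rw [h]; positivity
  · obtain ⟨n', hn', rfl⟩ : ∃ n', 0 ≤ n' ∧ n = 6 + n' := ⟨n - 6, by linarith, by ring⟩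
    have h : Qp (6 + n') 1 = 5 * n' ^ 3 + 64 * n' ^ 2 + 277 * n' + 422 := by unfold Qp; ring
    rw [h]; positivity
  · obtain ⟨k', hk', rfl⟩ : ∃ k', 0 ≤ k' ∧ k = 2 + k' := ⟨k - 2, by linarith, by ring⟩
    obtain ⟨f', hf', rfl⟩ : ∃ f', 0 ≤ f' ∧ n = 5 * (2 + k') + f' := ⟨n - 5 * (2 + k'), by linarith, by ring⟩
    have h : Qp (5 * (2 + k') + f') (2 + k') = 5 * f' ^ 3 + 75 * f' ^ 2 * k' + 375 * f' * k' ^ 2 + 625 * k' ^ 3 + 124 * f' ^ 2 + 1240 * f' * k' + 3100 * k' ^ 2 + 1029 * f' + 5145 * k' + 2874 := by unfold Qp; ring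
    rw [h]; positivity

/-- `Pp > 0` for `n ≥ 6`, `5k ≤ n`. -/
theorem Pp_pos (n k : ℚ) (hn : 6 ≤ n) (hk : 5 * k ≤ n) : 0 < Pp n k := by
  obtain ⟨n', hn', rfl⟩ : ∃ n', 0 ≤ n' ∧ n = 6 + n' := ⟨n - 6, by linarith, by ring⟩
  have h : Pp (6 + n') k = (6 + n') * (n' ^ 4 + 14 * n' ^ 3 + 71 * n' ^ 2 + 154 * n' + 96) - 120 * (k - (6 + n') / 5) := by
    unfold Pp; ring
  have h2 : 0 < (6 + n') * (n' ^ 4 + 14 * n' ^ 3 + 71 * n' ^ 2 + 154 * n' + 96) := by positivity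
  rw [h]
  nlinarith

/-- `Yc > 0` for `n ≥ 6`. -/
theorem Yc_pos (n : ℚ) (hn : 6 ≤ n) : 0 < Yc n := by
  obtain ⟨n', hn', rfl⟩ : ∃ n', 0 ≤ n' ∧ n = 6 + n' := ⟨n - 6, by linarith, by ring⟩
  have h : Yc (6 + n') = (1 / 720) * n' ^ 6 + (7 / 240) * n' ^ 5 + (35 / 144) * n' ^ 4 + (49 / 48) * n' ^ 3 + (203 / 90) * n' ^ 2 + (49 / 20) * n' + 1 := by unfold Yc; ring
  rw [h]; positivity

/-- `Pc = Pp / 120`. -/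
theorem Pc_eq (n k : ℚ) : Pc n k = Pp n k / 120 := by unfold Pc Pp; ring

/-- `Pc > 0` for `n ≥ 6`, `5k ≤ n`. -/
theorem Pc_pos (n k : ℚ) (hn : 6 ≤ n) (hk : 5 * k ≤ n) : 0 < Pc n k := by
  rw [Pc_eq]
  have h2 := Pp_pos n k hn hk
  positivity

end PercRepro.PuncturedLYM.Split.TypeLift.Unif55
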